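import Literature.Topology.FourManifolds.TrisectionsBandCalculus
import Literature.Topology.FourManifolds.SPC4HandleChainProofs
import HarnessLib

/-!
# The sectors cut out by the height and the top height; the Morse functions of the first and
# third sectors have no critical points in the band

Topic `Literature/Topology/FourManifolds`; step E4b of a Morse-theoretic construction of
Gay–Kirby's trisection for the fact seat
`provefact-Literature.Topology.FourManifolds.exists_isBalancedGKTrisection` (Gay–Kirby 2016,
Thm. 4 via §4, Lemma 14).  Everything in this file is **proved**; the definitions are explicit.

With `s = f - a` and a top height `T : X → ℝ` the three sectors are
`X₁ = {s ≤ 0, 2s ≤ T}`, `X₂ = {0 ≤ s ≤ T}`, `X₃ = {T ≤ 2s, T ≤ s}` (`sectorOne/Two/Three`); they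
cover `X` (`mem_sectorOne_or_two_or_three`), and their pairwise intersections are the faces
`{s = 0 ≤ T}`, `{s = T ≥ 0}`, `{2s = T ≤ 0}` with common boundary `{s = 0 = T}`
(`sectorOne_inter_sectorTwo`, …).

For the top height `T = HandleBoxes.topHeight …` of `TrisectionsTopHeight.lean`:

* `HandleBoxes.mlineDeriv_topHeight_eq` — on the whole band,
  `ξ(T) = ξ(f) · D`, `D = χ_lo'(s)(χ_hi(s) T_raw - S_top) + χ_hi'(s)(χ_lo(s) T_raw + S_min)`, and
  **`D ≤ 0`** (`HandleBoxes.topCoeff_nonpos`) when `χ_lo` is nondecreasing, `χ_hi` nonincreasing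
  and `-S_min ≤ T_raw ≤ S_top`;
* hence for `Ψ = Γ(T, f)`: `ξ(Ψ) = ξ(f) (∂₁Γ · D + ∂₂Γ)` (`mlineDeriv_comp₂_topHeight_band`), so
  **`Ψ₁ = U₁(-s) V₁(T/2 - s)` (`∂₁Γ ≥ 0`, `∂₂Γ < 0`) and `Ψ₃ = U₃(s - T/2) V₃(s - T)`
  (`∂₁Γ ≤ 0`, `∂₂Γ > 0`) have no critical points in the band** off the critical points of `f`
  (`not_isMCriticalPt_of_partials`); below (resp. above) the band they are functions of `f`,
  whose Morse data are those of `f` (`TrisectionsBandCalculus.morseData_real_comp`).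

## References

* D. Gay, R. Kirby, *Trisecting 4-manifolds*, Geom. Topol. 20 (2016), §4, Lemma 14. [GayKirby2016]
* J. Milnor, *Lectures on the h-cobordism theorem* (1965), Def. 3.1, Thm. 3.4. [MilnorHCobordism1965]
-/

open scoped Manifold ContDiff Topology
open Set Function Filter Metric

noncomputable section

universe u

namespace Literature.Topology.FourManifolds

open Flow

/-- Local notation: `𝔼 n` is the model Euclidean space `EuclideanSpace ℝ (Fin n)`. -/
local notation "𝔼 " n:arg => EuclideanSpace ℝ (Fin n)

/-! ### The three sectors of two functions -/

section Sectors

variable {X : Type u} (f : X → ℝ) (a : ℝ) (T : X → ℝ)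

/-- **The first sector** `X₁ = {s ≤ 0, 2s ≤ T}` (`s = f - a`). [cite: GayKirby2016, §4, Lemma 14] -/
def sectorOne : Set X := {z | f z - a ≤ 0 ∧ 2 * (f z - a) ≤ T z}

/-- **The second sector** `X₂ = {0 ≤ s ≤ T}`. [cite: GayKirby2016, §4, Lemma 14] -/
def sectorTwo : Set X := {z | 0 ≤ f z - a ∧ f z - a ≤ T z}

/-- **The third sector** `X₃ = {T ≤ 2s, T ≤ s}`. [cite: GayKirby2016, §4, Lemma 14] -/
def sectorThree : Set X := {z | T z ≤ 2 * (f z - a) ∧ T z ≤ f z - a}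

variable {f a T}

/-- Membership in `X₁`. [folklore] -/
theorem mem_sectorOne {z : X} : z ∈ sectorOne f a T ↔ f z - a ≤ 0 ∧ 2 * (f z - a) ≤ T z := Iff.rfl
/-- Membership in `X₂`. [folklore] -/
theorem mem_sectorTwo {z : X} : z ∈ sectorTwo f a T ↔ 0 ≤ f z - a ∧ f z - a ≤ T z := Iff.rfl
/-- Membership in `X₃`. [folklore] -/
theorem mem_sectorThree {z : X} : z ∈ sectorThree f a T ↔ T z ≤ 2 * (f z - a) ∧ T z ≤ f z - a := Iff.rfl

/-- **The three sectors cover `X`.** [cite: GayKirby2016, Def. 1] -/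
theorem mem_sectorOne_or_two_or_three (z : X) :
    z ∈ sectorOne f a T ∨ z ∈ sectorTwo f a T ∨ z ∈ sectorThree f a T := by
  simp only [mem_sectorOne, mem_sectorTwo, mem_sectorThree]
  rcases le_or_gt (f z - a) 0 with hs | hs
  · rcases le_or_gt (2 * (f z - a)) (T z) with h2 | h2
    · exact Or.inl ⟨hs, h2⟩
    · exact Or.inr (Or.inr ⟨h2.le, by linarith⟩)
  · rcases le_or_gt (f z - a) (T z) with h2 | h2
    · exact Or.inr (Or.inl ⟨hs.le, h2⟩)
    · exact Or.inr (Or.inr ⟨by linarith, h2.le⟩)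

/-- `X₁ ∩ X₂ = {s = 0 ≤ T}`. [cite: GayKirby2016, §4, Lemma 14] -/
theorem sectorOne_inter_sectorTwo :
    sectorOne f a T ∩ sectorTwo f a T = {z | f z - a = 0 ∧ 0 ≤ T z} := by
  ext z
  simp only [mem_inter_iff, mem_sectorOne, mem_sectorTwo, mem_setOf_eq]
  constructor
  · rintro ⟨⟨h1, h2⟩, h3, h4⟩
    exact ⟨le_antisymm h1 h3, by linarith⟩
  · rintro ⟨h1, h2⟩
    refine ⟨⟨h1.le, by linarith⟩, h1.ge, by linarith⟩

/-- `X₂ ∩ X₃ = {s = T ≥ 0}` (the top face). [cite: GayKirby2016, §4, Lemma 14] -/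
theorem sectorTwo_inter_sectorThree :
    sectorTwo f a T ∩ sectorThree f a T = {z | f z - a = T z ∧ 0 ≤ T z} := by
  ext z
  simp only [mem_inter_iff, mem_sectorTwo, mem_sectorThree, mem_setOf_eq]
  constructor
  · rintro ⟨⟨h1, h2⟩, h3, h4⟩
    exact ⟨le_antisymm h2 h4, by linarith [le_antisymm h2 h4]⟩
  · rintro ⟨h1, h2⟩
    refine ⟨⟨by linarith, h1.le⟩, by linarith, h1.ge⟩

/-- `X₁ ∩ X₃ = {2s = T ≤ 0}` (the bevel). [cite: GayKirby2016, §4, Lemma 14] -/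
theorem sectorOne_inter_sectorThree :
    sectorOne f a T ∩ sectorThree f a T = {z | 2 * (f z - a) = T z ∧ T z ≤ 0} := by
  ext z
  simp only [mem_inter_iff, mem_sectorOne, mem_sectorThree, mem_setOf_eq]
  constructor
  · rintro ⟨⟨h1, h2⟩, h3, h4⟩
    exact ⟨le_antisymm h2 h3, by linarith [le_antisymm h2 h3]⟩
  · rintro ⟨h1, h2⟩
    refine ⟨⟨by linarith, h1.le⟩, h1.ge, by linarith⟩

/-- **The triple intersection is the central surface `{s = 0 = T}`.** [cite: GayKirby2016, Def. 1] -/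
theorem sectorOne_inter_sectorTwo_inter_sectorThree :
    sectorOne f a T ∩ sectorTwo f a T ∩ sectorThree f a T = {z | f z - a = 0 ∧ T z = 0} := by
  rw [sectorOne_inter_sectorTwo]
  ext z
  simp only [mem_inter_iff, mem_setOf_eq, mem_sectorThree]
  constructor
  · rintro ⟨⟨h1, h2⟩, h3, h4⟩
    exact ⟨h1, by linarith⟩
  · rintro ⟨h1, h2⟩
    exact ⟨⟨h1, h2.ge⟩, by linarith, by linarith⟩

/-- The sectors are closed when `f` and `T` are continuous. [folklore] -/
theorem isClosed_sectorOne [TopologicalSpace X] (hf : Continuous f) (hT : Continuous T) :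
    IsClosed (sectorOne f a T) :=
  (isClosed_le (hf.sub continuous_const) continuous_const).inter
    (isClosed_le (continuous_const.mul (hf.sub continuous_const)) hT)

/-- The sectors are closed when `f` and `T` are continuous. [folklore] -/
theorem isClosed_sectorTwo [TopologicalSpace X] (hf : Continuous f) (hT : Continuous T) :
    IsClosed (sectorTwo f a T) :=
  (isClosed_le continuous_const (hf.sub continuous_const)).inter (isClosed_le (hf.sub continuous_const) hT)

/-- The sectors are closed when `f` and `T` are continuous. [folklore] -/
theorem isClosed_sectorThree [TopologicalSpace X] (hf : Continuous f) (hT : Continuous T) :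
    IsClosed (sectorThree f a T) :=
  (isClosed_le hT (continuous_const.mul (hf.sub continuous_const))).inter
    (isClosed_le hT (hf.sub continuous_const))

end Sectors

/-! ### The derivative of the top height along the field on the whole band -/

section Band

variable {X : Type u} [TopologicalSpace X] [T2Space X] [CompactSpace X] [ChartedSpace (𝔼 4) X]
  [IsManifold (𝓡 4) ∞ X]
  {f : X → ℝ} {ξ : Π x : X, TangentSpace (𝓡 4) x} {a η : ℝ} {ι : Type} [Fintype ι]
  (H : HandleBoxes f ξ a η ι)
  {hξ : ContMDiff (𝓡 4) (𝓡 4).tangent ∞ fun x => (⟨x, ξ x⟩ : TangentBundle (𝓡 4) X)}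
  {h : IsRegularLevel (𝓡 4) f a} {φ : RegularLevel h → ℝ} {h₂ TP χlo χhi : ℝ → ℝ} {Stop Smin Psw : ℝ}

namespace HandleBoxes

/-- **The coefficient `D` of `ξ(T) = D · ξ(f)`**:
`D = χ_lo'(s)(χ_hi(s) T_raw - S_top) + χ_hi'(s)(χ_lo(s) T_raw + S_min)`. [folklore] -/
def topCoeff (hξ : ContMDiff (𝓡 4) (𝓡 4).tangent ∞ fun x => (⟨x, ξ x⟩ : TangentBundle (𝓡 4) X))
    (h : IsRegularLevel (𝓡 4) f a) (φ : RegularLevel h → ℝ) (h₂ TP χlo χhi : ℝ → ℝ)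
    (Stop Smin Psw : ℝ) (z : X) : ℝ :=
  deriv χlo (f z - a) * (χhi (f z - a) * H.topRaw hξ h φ h₂ TP Stop Psw z - Stop) +
    deriv χhi (f z - a) * (χlo (f z - a) * H.topRaw hξ h φ h₂ TP Stop Psw z + Smin)

/-- **`ξ(T) = D · ξ(f)` on the band.** [cite: GayKirby2016, §4, Lemma 14] -/
theorem mlineDeriv_topHeight_eq (hgl : IsGradientLike (𝓡 4) f ξ) (hfM : IsMorse (𝓡 4) f)
    (hT : ContMDiff (𝓡 4) 𝓘(ℝ, ℝ) ∞ (H.topHeight hξ h φ h₂ TP χlo χhi Stop Smin Psw))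
    (hχlo : ContDiff ℝ ∞ χlo) (hχhi : ContDiff ℝ ∞ χhi)
    {P₁ v₁ : ℝ} (hPsw0 : 0 < Psw) (hPsw : 2 * Psw ≤ η ^ 2) (hP₁ : 2 * P₁ < Psw)
    (hTP₂ : ∀ P, 2 * P₁ ≤ P → TP P = Stop) (hh₂v : ∀ t ≤ v₁, h₂ t = Stop)
    (hφv : ∀ j (y : RegularLevel h), y.1 ∈ (H.box j).chart.source → H.P j y.1 < 2 * Psw → φ y ≤ v₁)
    {z : X} (hf₁ : a - η < f z) (hf₂ : f z < a + 2 * η) :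
    mlineDeriv (𝓡 4) (H.topHeight hξ h φ h₂ TP χlo χhi Stop Smin Psw) z (ξ z) =
      H.topCoeff hξ h φ h₂ TP χlo χhi Stop Smin Psw z * mlineDeriv (𝓡 4) f z (ξ z) := by
  have hθ : IsFlowOf (𝓡 4) ξ (flowθ hξ) := (isSmoothFlow_flow hξ).isFlowOf
  set R := H.topRaw hξ h φ h₂ TP Stop Psw z with hR
  set β := mlineDeriv (𝓡 4) f z (ξ z) with hβ
  -- the derivative of `T` along the orbit, from the library
  have hder : HasDerivAt (fun t : ℝ => H.topHeight hξ h φ h₂ TP χlo χhi Stop Smin Psw (flow hξ z t))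
      (mlineDeriv (𝓡 4) (H.topHeight hξ h φ h₂ TP χlo χhi Stop Smin Psw) (flow hξ z 0) (ξ (flow hξ z 0))) 0 :=
    hθ.hasDerivAt_apply hT z 0
  -- the derivative of `s` along the orbit
  have hds : HasDerivAt (fun t : ℝ => f (flow hξ z t) - a) β 0 := by
    have := hθ.hasDerivAt_apply hfM.contMDiff z 0
    simp only [flowθ] at this
    rw [flow_zero] at this
    exact this.sub_const a
  -- the explicit expression along the orbit, valid for small times
  have hev : (fun t : ℝ => H.topHeight hξ h φ h₂ TP χlo χhi Stop Smin Psw (flow hξ z t)) =ᶠ[𝓝 0]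
      fun t => χlo (f (flow hξ z t) - a) * χhi (f (flow hξ z t) - a) * R +
        (1 - χlo (f (flow hξ z t) - a)) * Stop - (1 - χhi (f (flow hξ z t) - a)) * Smin := by
    filter_upwards [H.topRaw_flow_eventuallyEq hgl hfM hPsw0 hPsw hP₁ hTP₂ hh₂v hφv hf₁ hf₂] with t ht
    show H.topHeight hξ h φ h₂ TP χlo χhi Stop Smin Psw (flow hξ z t) = _
    unfold topHeight
    rw [ht]
  have hlo : HasDerivAt (fun t : ℝ => χlo (f (flow hξ z t) - a)) (deriv χlo (f z - a) * β) 0 := by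
    have := ((hχlo.differentiable (by simp)) _).hasDerivAt.comp (0 : ℝ) hds
    simpa [flow_zero, Function.comp_def] using this
  have hhi : HasDerivAt (fun t : ℝ => χhi (f (flow hξ z t) - a)) (deriv χhi (f z - a) * β) 0 := by
    have := ((hχhi.differentiable (by simp)) _).hasDerivAt.comp (0 : ℝ) hds
    simpa [flow_zero, Function.comp_def] using this
  have hexpl : HasDerivAt (fun t : ℝ => χlo (f (flow hξ z t) - a) * χhi (f (flow hξ z t) - a) * R +
        (1 - χlo (f (flow hξ z t) - a)) * Stop - (1 - χhi (f (flow hξ z t) - a)) * Smin)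
      ((deriv χlo (f z - a) * β * χhi (f (flow hξ z 0) - a) + χlo (f (flow hξ z 0) - a) * (deriv χhi (f z - a) * β)) * R +
        (0 - deriv χlo (f z - a) * β) * Stop - (0 - deriv χhi (f z - a) * β) * Smin) 0 :=
    (((hlo.mul hhi).mul_const R).add (((hasDerivAt_const _ _).sub hlo).mul_const Stop)).sub
      (((hasDerivAt_const _ _).sub hhi).mul_const Smin)
  have h2 : HasDerivAt (fun t : ℝ => H.topHeight hξ h φ h₂ TP χlo χhi Stop Smin Psw (flow hξ z t)) _ 0 :=
    hexpl.congr_of_eventuallyEq hev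
  have huniq := hder.unique h2
  rw [flow_zero] at huniq
  rw [huniq]
  simp only [topCoeff]
  ring

/-- **Bounds of the raw top height**: `-S_min ≤ T_raw ≤ S_top` when `T_P` and `h₂` take values in
`[-S_min, S_top]`. [folklore] -/
theorem topRaw_mem_Icc (hTP : ∀ P, TP P ∈ Icc (-Smin) Stop) (hh₂ : ∀ t, h₂ t ∈ Icc (-Smin) Stop)
    (hS : -Smin ≤ Stop) (z : X) : H.topRaw hξ h φ h₂ TP Stop Psw z ∈ Icc (-Smin) Stop := by
  by_cases h1 : ∃ j, z ∈ H.swSet Psw j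
  · obtain ⟨j, hz⟩ := h1
    rw [H.topRaw_of_mem_swSet hz]; exact hTP _
  · push Not at h1
    rw [H.topRaw_of_forall_not_mem h1]
    by_cases hh : Hits (flowθ hξ) f a z
    · rw [satLift_of_hits hh]; exact hh₂ _
    · rw [satLift_of_not_hits hh]; exact ⟨hS, le_rfl⟩

/-- **`D ≤ 0`**: for `χ_lo` nondecreasing and `χ_hi` nonincreasing at `s`, both valued in
`[0, 1]`, `0 ≤ S_top`, `0 ≤ S_min` and `-S_min ≤ T_raw ≤ S_top`. [folklore] -/
theorem topCoeff_nonpos {z : X} (hlo' : 0 ≤ deriv χlo (f z - a)) (hhi' : deriv χhi (f z - a) ≤ 0)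
    (hlo : χlo (f z - a) ∈ Icc (0 : ℝ) 1) (hhi : χhi (f z - a) ∈ Icc (0 : ℝ) 1)
    (hStop : 0 ≤ Stop) (hSmin : 0 ≤ Smin)
    (hR : H.topRaw hξ h φ h₂ TP Stop Psw z ∈ Icc (-Smin) Stop) :
    H.topCoeff hξ h φ h₂ TP χlo χhi Stop Smin Psw z ≤ 0 := by
  unfold topCoeff
  set R := H.topRaw hξ h φ h₂ TP Stop Psw z
  have h1 : χhi (f z - a) * R - Stop ≤ 0 := by
    rcases le_or_gt 0 R with hR0 | hR0
    · nlinarith [hhi.1, hhi.2, hR.2]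
    · nlinarith [hhi.1, hhi.2]
  have h2 : 0 ≤ χlo (f z - a) * R + Smin := by
    rcases le_or_gt 0 R with hR0 | hR0
    · nlinarith [hlo.1, hlo.2]
    · nlinarith [hlo.1, hlo.2, hR.1]
  nlinarith [mul_nonpos_of_nonneg_of_nonpos hlo' h1, mul_nonpos_of_nonpos_of_nonneg hhi' h2]

/-- **`ξ(Γ(T, f)) = ξ(f) (∂₁Γ · D + ∂₂Γ)` on the band.** [cite: GayKirby2016, §4, Lemma 14] -/
theorem mlineDeriv_comp₂_topHeight_band (hgl : IsGradientLike (𝓡 4) f ξ) (hfM : IsMorse (𝓡 4) f)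
    (hT : ContMDiff (𝓡 4) 𝓘(ℝ, ℝ) ∞ (H.topHeight hξ h φ h₂ TP χlo χhi Stop Smin Psw))
    (hχlo : ContDiff ℝ ∞ χlo) (hχhi : ContDiff ℝ ∞ χhi)
    {P₁ v₁ : ℝ} (hPsw0 : 0 < Psw) (hPsw : 2 * Psw ≤ η ^ 2) (hP₁ : 2 * P₁ < Psw)
    (hTP₂ : ∀ P, 2 * P₁ ≤ P → TP P = Stop) (hh₂v : ∀ t ≤ v₁, h₂ t = Stop)
    (hφv : ∀ j (y : RegularLevel h), y.1 ∈ (H.box j).chart.source → H.P j y.1 < 2 * Psw → φ y ≤ v₁)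
    {Γ : ℝ × ℝ → ℝ} {z : X} (hΓ : DifferentiableAt ℝ Γ (H.topHeight hξ h φ h₂ TP χlo χhi Stop Smin Psw z, f z))
    (hf₁ : a - η < f z) (hf₂ : f z < a + 2 * η) :
    mlineDeriv (𝓡 4) (fun w => Γ (H.topHeight hξ h φ h₂ TP χlo χhi Stop Smin Psw w, f w)) z (ξ z) =
      mlineDeriv (𝓡 4) f z (ξ z) *
        (fderiv ℝ Γ (H.topHeight hξ h φ h₂ TP χlo χhi Stop Smin Psw z, f z) (1, 0) *
            H.topCoeff hξ h φ h₂ TP χlo χhi Stop Smin Psw z +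
          fderiv ℝ Γ (H.topHeight hξ h φ h₂ TP χlo χhi Stop Smin Psw z, f z) (0, 1)) := by
  rw [mlineDeriv_comp₂_eq ((hT z).mdifferentiableAt (by simp)) (hfM.contMDiff.mdifferentiableAt (by simp)) hΓ,
    H.mlineDeriv_topHeight_eq hgl hfM hT hχlo hχhi hPsw0 hPsw hP₁ hTP₂ hh₂v hφv hf₁ hf₂, fderiv_prod_apply']
  ring

/-- **No critical point of `Γ(T, f)` on the band where `∂₁Γ · D + ∂₂Γ ≠ 0`**, off the critical
points of `f`. [cite: GayKirby2016, §4, Lemma 14] [cite: MilnorHCobordism1965, Def. 3.1] -/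
theorem not_isMCriticalPt_comp₂_of_ne (hgl : IsGradientLike (𝓡 4) f ξ) (hfM : IsMorse (𝓡 4) f)
    (hT : ContMDiff (𝓡 4) 𝓘(ℝ, ℝ) ∞ (H.topHeight hξ h φ h₂ TP χlo χhi Stop Smin Psw))
    (hχlo : ContDiff ℝ ∞ χlo) (hχhi : ContDiff ℝ ∞ χhi)
    {P₁ v₁ : ℝ} (hPsw0 : 0 < Psw) (hPsw : 2 * Psw ≤ η ^ 2) (hP₁ : 2 * P₁ < Psw)
    (hTP₂ : ∀ P, 2 * P₁ ≤ P → TP P = Stop) (hh₂v : ∀ t ≤ v₁, h₂ t = Stop)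
    (hφv : ∀ j (y : RegularLevel h), y.1 ∈ (H.box j).chart.source → H.P j y.1 < 2 * Psw → φ y ≤ v₁)
    {Γ : ℝ × ℝ → ℝ} {z : X} (hΓ : DifferentiableAt ℝ Γ (H.topHeight hξ h φ h₂ TP χlo χhi Stop Smin Psw z, f z))
    (hne : fderiv ℝ Γ (H.topHeight hξ h φ h₂ TP χlo χhi Stop Smin Psw z, f z) (1, 0) *
        H.topCoeff hξ h φ h₂ TP χlo χhi Stop Smin Psw z +
      fderiv ℝ Γ (H.topHeight hξ h φ h₂ TP χlo χhi Stop Smin Psw z, f z) (0, 1) ≠ 0)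
    (hz : ¬ IsMCriticalPt (𝓡 4) f z) (hf₁ : a - η < f z) (hf₂ : f z < a + 2 * η) :
    ¬ IsMCriticalPt (𝓡 4) (fun w => Γ (H.topHeight hξ h φ h₂ TP χlo χhi Stop Smin Psw w, f w)) z := by
  intro hc
  have h0 : mlineDeriv (𝓡 4) (fun w => Γ (H.topHeight hξ h φ h₂ TP χlo χhi Stop Smin Psw w, f w)) z (ξ z) = 0 := by
    rw [mlineDeriv_def]; unfold IsMCriticalPt at hc; rw [hc]; rfl
  rw [H.mlineDeriv_comp₂_topHeight_band hgl hfM hT hχlo hχhi hPsw0 hPsw hP₁ hTP₂ hh₂v hφv hΓ hf₁ hf₂] at h0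
  rcases mul_eq_zero.1 h0 with h' | h'
  · exact absurd h' (hgl.mlineDeriv_pos z hz).ne'
  · exact hne h'

omit [T2Space X] [CompactSpace X] [IsManifold (𝓡 4) ∞ X] [Fintype ι] in
include H in
/-- No critical point of `f` on the band outside the level `a + η`. [folklore] -/
theorem not_isMCriticalPt_of_band {z : X} (hf₁ : a - η ≤ f z) (hf₂ : f z < a + 2 * η) (hne : f z ≠ a + η) :
    ¬ IsMCriticalPt (𝓡 4) f z := by
  intro hc
  obtain ⟨j, rfl⟩ := H.crit_val z hc hf₁ hf₂
  exact hne (H.apply_cpt j)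

end HandleBoxes

/-! ### Partial derivatives of the two product profiles -/

section Profiles

/-- A Fréchet derivative applied to a vector is the derivative along the line. [folklore] -/
theorem fderiv_apply_eq_deriv_line {Γ : ℝ × ℝ → ℝ} {p : ℝ × ℝ} (hΓ : DifferentiableAt ℝ Γ p) (v : ℝ × ℝ) :
    fderiv ℝ Γ p v = deriv (fun t : ℝ => Γ (p + t • v)) 0 := by
  have hl : HasDerivAt (fun t : ℝ => p + t • v) v 0 := by
    simpa using ((hasDerivAt_id (0 : ℝ)).smul_const v).const_add p
  have hp0 : p + (0 : ℝ) • v = p := by simp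
  have hF := hΓ.hasFDerivAt
  rw [← hp0] at hF
  have := hF.comp_hasDerivAt (0 : ℝ) hl
  simp only [zero_smul, add_zero] at this
  exact (this.deriv).symm

/-- **`Γ₁(p, q) = U(a - q) · V(p/2 - (q - a))`** (the first sector's function `U₁(-s) V₁(T/2 - s)`
as a function of `(T, f)`): differentiability and the two partials
`∂₁Γ₁ = U V'/2`, `∂₂Γ₁ = -(U'V + U V')`. [folklore] -/
theorem gammaOne_partials {U V : ℝ → ℝ} (hU : ContDiff ℝ ∞ U) (hV : ContDiff ℝ ∞ V) (a : ℝ) (p : ℝ × ℝ) :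
    DifferentiableAt ℝ (fun r : ℝ × ℝ => U (a - r.2) * V (r.1 / 2 - (r.2 - a))) p ∧
      fderiv ℝ (fun r : ℝ × ℝ => U (a - r.2) * V (r.1 / 2 - (r.2 - a))) p (1, 0) =
        U (a - p.2) * deriv V (p.1 / 2 - (p.2 - a)) / 2 ∧
      fderiv ℝ (fun r : ℝ × ℝ => U (a - r.2) * V (r.1 / 2 - (r.2 - a))) p (0, 1) =
        -(deriv U (a - p.2) * V (p.1 / 2 - (p.2 - a)) + U (a - p.2) * deriv V (p.1 / 2 - (p.2 - a))) := by
  have hUd := hU.differentiable (by simp)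
  have hVd := hV.differentiable (by simp)
  have hd1 : Differentiable ℝ fun r : ℝ × ℝ => a - r.2 := (differentiable_const a).sub differentiable_snd
  have hd0 : Differentiable ℝ fun r : ℝ × ℝ => r.1 / 2 := by fun_prop
  have hd2 : Differentiable ℝ fun r : ℝ × ℝ => r.1 / 2 - (r.2 - a) :=
    hd0.sub (differentiable_snd.sub (differentiable_const a))
  have hdiff : Differentiable ℝ (fun r : ℝ × ℝ => U (a - r.2) * V (r.1 / 2 - (r.2 - a))) :=
    (hUd.comp hd1).mul (hVd.comp hd2)
  refine ⟨hdiff p, ?_, ?_⟩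
  · rw [fderiv_apply_eq_deriv_line (hdiff p)]
    have hfun : (fun t : ℝ => (fun r : ℝ × ℝ => U (a - r.2) * V (r.1 / 2 - (r.2 - a))) (p + t • ((1 : ℝ), (0 : ℝ)))) =
        fun t => U (a - p.2) * V ((p.1 / 2 - (p.2 - a)) + t / 2) := by
      funext t; simp only [Prod.smul_mk, smul_eq_mul, mul_one, mul_zero, Prod.fst_add, Prod.snd_add, add_zero]; ring_nf
    rw [hfun]
    have hin : HasDerivAt (fun t : ℝ => (p.1 / 2 - (p.2 - a)) + t / 2) (1 / 2) 0 := by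
      simpa using ((hasDerivAt_id (0 : ℝ)).div_const 2).const_add (p.1 / 2 - (p.2 - a))
    have h1 : HasDerivAt (fun t : ℝ => V ((p.1 / 2 - (p.2 - a)) + t / 2)) (deriv V ((p.1 / 2 - (p.2 - a)) + 0 / 2) * (1 / 2)) 0 :=
      (hVd ((p.1 / 2 - (p.2 - a)) + 0 / 2)).hasDerivAt.comp (0 : ℝ) hin
    have h2 : HasDerivAt (fun t : ℝ => U (a - p.2) * V ((p.1 / 2 - (p.2 - a)) + t / 2))
        (U (a - p.2) * (deriv V ((p.1 / 2 - (p.2 - a)) + 0 / 2) * (1 / 2))) 0 := h1.const_mul _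
    rw [h2.deriv]
    simp only [zero_div, add_zero]
    ring
  · rw [fderiv_apply_eq_deriv_line (hdiff p)]
    have hfun : (fun t : ℝ => (fun r : ℝ × ℝ => U (a - r.2) * V (r.1 / 2 - (r.2 - a))) (p + t • ((0 : ℝ), (1 : ℝ)))) =
        fun t => U ((a - p.2) - t) * V ((p.1 / 2 - (p.2 - a)) - t) := by
      funext t; simp only [Prod.smul_mk, smul_eq_mul, mul_one, mul_zero, Prod.fst_add, Prod.snd_add, add_zero]; ring_nf
    rw [hfun]
    have hin1 : HasDerivAt (fun t : ℝ => (a - p.2) - t) (-1) 0 := by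
      simpa using (hasDerivAt_id (0 : ℝ)).const_sub (a - p.2)
    have h1 : HasDerivAt (fun t : ℝ => U ((a - p.2) - t)) (deriv U ((a - p.2) - 0) * (-1)) 0 :=
      (hUd ((a - p.2) - 0)).hasDerivAt.comp (0 : ℝ) hin1
    have hin2 : HasDerivAt (fun t : ℝ => (p.1 / 2 - (p.2 - a)) - t) (-1) 0 := by
      simpa using (hasDerivAt_id (0 : ℝ)).const_sub (p.1 / 2 - (p.2 - a))
    have h2 : HasDerivAt (fun t : ℝ => V ((p.1 / 2 - (p.2 - a)) - t)) (deriv V ((p.1 / 2 - (p.2 - a)) - 0) * (-1)) 0 :=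
      (hVd ((p.1 / 2 - (p.2 - a)) - 0)).hasDerivAt.comp (0 : ℝ) hin2
    have h12 : HasDerivAt (fun t : ℝ => U ((a - p.2) - t) * V ((p.1 / 2 - (p.2 - a)) - t)) _ 0 := h1.mul h2
    rw [h12.deriv]
    simp only [sub_zero]
    ring

/-- **`Γ₃(p, q) = U((q - a) - p/2) · V((q - a) - p)`** (the third sector's function
`U₃(s - T/2) V₃(s - T)`): differentiability and the partials `∂₁Γ₃ = -(U'V/2 + U V')`,
`∂₂Γ₃ = U'V + U V'`. [folklore] -/
theorem gammaThree_partials {U V : ℝ → ℝ} (hU : ContDiff ℝ ∞ U) (hV : ContDiff ℝ ∞ V) (a : ℝ) (p : ℝ × ℝ) :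
    DifferentiableAt ℝ (fun r : ℝ × ℝ => U ((r.2 - a) - r.1 / 2) * V ((r.2 - a) - r.1)) p ∧
      fderiv ℝ (fun r : ℝ × ℝ => U ((r.2 - a) - r.1 / 2) * V ((r.2 - a) - r.1)) p (1, 0) =
        -(deriv U ((p.2 - a) - p.1 / 2) * V ((p.2 - a) - p.1) / 2 + U ((p.2 - a) - p.1 / 2) * deriv V ((p.2 - a) - p.1)) ∧
      fderiv ℝ (fun r : ℝ × ℝ => U ((r.2 - a) - r.1 / 2) * V ((r.2 - a) - r.1)) p (0, 1) =
        deriv U ((p.2 - a) - p.1 / 2) * V ((p.2 - a) - p.1) + U ((p.2 - a) - p.1 / 2) * deriv V ((p.2 - a) - p.1) := by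
  have hUd := hU.differentiable (by simp)
  have hVd := hV.differentiable (by simp)
  have hd0 : Differentiable ℝ fun r : ℝ × ℝ => r.1 / 2 := by fun_prop
  have hd1 : Differentiable ℝ fun r : ℝ × ℝ => (r.2 - a) - r.1 / 2 :=
    (differentiable_snd.sub (differentiable_const a)).sub hd0
  have hd2 : Differentiable ℝ fun r : ℝ × ℝ => (r.2 - a) - r.1 :=
    (differentiable_snd.sub (differentiable_const a)).sub differentiable_fst
  have hdiff : Differentiable ℝ (fun r : ℝ × ℝ => U ((r.2 - a) - r.1 / 2) * V ((r.2 - a) - r.1)) :=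
    (hUd.comp hd1).mul (hVd.comp hd2)
  refine ⟨hdiff p, ?_, ?_⟩
  · rw [fderiv_apply_eq_deriv_line (hdiff p)]
    have hfun : (fun t : ℝ => (fun r : ℝ × ℝ => U ((r.2 - a) - r.1 / 2) * V ((r.2 - a) - r.1)) (p + t • ((1 : ℝ), (0 : ℝ)))) =
        fun t => U (((p.2 - a) - p.1 / 2) - t / 2) * V (((p.2 - a) - p.1) - t) := by
      funext t; simp only [Prod.smul_mk, smul_eq_mul, mul_one, mul_zero, Prod.fst_add, Prod.snd_add, add_zero]; ring_nf
    rw [hfun]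
    have hin1 : HasDerivAt (fun t : ℝ => ((p.2 - a) - p.1 / 2) - t / 2) (-(1 / 2)) 0 := by
      simpa using ((hasDerivAt_id (0 : ℝ)).div_const 2).const_sub ((p.2 - a) - p.1 / 2)
    have h1 : HasDerivAt (fun t : ℝ => U (((p.2 - a) - p.1 / 2) - t / 2)) (deriv U (((p.2 - a) - p.1 / 2) - 0 / 2) * (-(1 / 2))) 0 :=
      (hUd (((p.2 - a) - p.1 / 2) - 0 / 2)).hasDerivAt.comp (0 : ℝ) hin1
    have hin2 : HasDerivAt (fun t : ℝ => ((p.2 - a) - p.1) - t) (-1) 0 := by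
      simpa using (hasDerivAt_id (0 : ℝ)).const_sub ((p.2 - a) - p.1)
    have h2 : HasDerivAt (fun t : ℝ => V (((p.2 - a) - p.1) - t)) (deriv V (((p.2 - a) - p.1) - 0) * (-1)) 0 :=
      (hVd (((p.2 - a) - p.1) - 0)).hasDerivAt.comp (0 : ℝ) hin2
    have h12 : HasDerivAt (fun t : ℝ => U (((p.2 - a) - p.1 / 2) - t / 2) * V (((p.2 - a) - p.1) - t)) _ 0 := h1.mul h2
    rw [h12.deriv]
    simp only [sub_zero, zero_div]
    ring
  · rw [fderiv_apply_eq_deriv_line (hdiff p)]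
    have hfun : (fun t : ℝ => (fun r : ℝ × ℝ => U ((r.2 - a) - r.1 / 2) * V ((r.2 - a) - r.1)) (p + t • ((0 : ℝ), (1 : ℝ)))) =
        fun t => U (((p.2 - a) - p.1 / 2) + t) * V (((p.2 - a) - p.1) + t) := by
      funext t; simp only [Prod.smul_mk, smul_eq_mul, mul_one, mul_zero, Prod.fst_add, Prod.snd_add, add_zero]; ring_nf
    rw [hfun]
    have h1 : HasDerivAt (fun t : ℝ => U (((p.2 - a) - p.1 / 2) + t)) (deriv U (((p.2 - a) - p.1 / 2) + 0)) 0 :=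
      HasDerivAt.comp_const_add ((p.2 - a) - p.1 / 2) 0 (hUd (((p.2 - a) - p.1 / 2) + 0)).hasDerivAt
    have h2 : HasDerivAt (fun t : ℝ => V (((p.2 - a) - p.1) + t)) (deriv V (((p.2 - a) - p.1) + 0)) 0 :=
      HasDerivAt.comp_const_add ((p.2 - a) - p.1) 0 (hVd (((p.2 - a) - p.1) + 0)).hasDerivAt
    have h12 : HasDerivAt (fun t : ℝ => U (((p.2 - a) - p.1 / 2) + t) * V (((p.2 - a) - p.1) + t)) _ 0 := h1.mul h2
    rw [h12.deriv]
    simp only [add_zero]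

end Profiles

/-! ### The Morse functions of the first and third sectors -/

namespace HandleBoxes

/-- **The first sector's function** `ψ₁ = 1 - C · U₁(-s) · V₁(T/2 - s)`. [cite: GayKirby2016, §4, Lemma 14] -/
def psiOne (hξ : ContMDiff (𝓡 4) (𝓡 4).tangent ∞ fun x => (⟨x, ξ x⟩ : TangentBundle (𝓡 4) X))
    (h : IsRegularLevel (𝓡 4) f a) (φ : RegularLevel h → ℝ) (h₂ TP χlo χhi : ℝ → ℝ)
    (Stop Smin Psw : ℝ) (U₁ V₁ : ℝ → ℝ) (C : ℝ) (z : X) : ℝ :=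
  1 - C * (U₁ (a - f z) * V₁ (H.topHeight hξ h φ h₂ TP χlo χhi Stop Smin Psw z / 2 - (f z - a)))

/-- **The third sector's function** `ψ₃ = 1 - C · U₃(s - T/2) · V₃(s - T)`. [cite: GayKirby2016, §4, Lemma 14] -/
def psiThree (hξ : ContMDiff (𝓡 4) (𝓡 4).tangent ∞ fun x => (⟨x, ξ x⟩ : TangentBundle (𝓡 4) X))
    (h : IsRegularLevel (𝓡 4) f a) (φ : RegularLevel h → ℝ) (h₂ TP χlo χhi : ℝ → ℝ)
    (Stop Smin Psw : ℝ) (U₃ V₃ : ℝ → ℝ) (C : ℝ) (z : X) : ℝ :=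
  1 - C * (U₃ ((f z - a) - H.topHeight hξ h φ h₂ TP χlo χhi Stop Smin Psw z / 2) *
    V₃ ((f z - a) - H.topHeight hξ h φ h₂ TP χlo χhi Stop Smin Psw z))

variable {U₁ V₁ U₃ V₃ : ℝ → ℝ} {C : ℝ}

/-- `ψ₁` as `Γ(T, f)` with `Γ(p, q) = 1 - C U₁(a - q) V₁(p/2 - (q - a))`. [folklore] -/
theorem psiOne_eq : H.psiOne hξ h φ h₂ TP χlo χhi Stop Smin Psw U₁ V₁ C = fun z =>
    (fun r : ℝ × ℝ => 1 - C * (U₁ (a - r.2) * V₁ (r.1 / 2 - (r.2 - a))))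
      (H.topHeight hξ h φ h₂ TP χlo χhi Stop Smin Psw z, f z) := rfl

/-- `ψ₃` as `Γ(T, f)` with `Γ(p, q) = 1 - C U₃((q - a) - p/2) V₃((q - a) - p)`. [folklore] -/
theorem psiThree_eq : H.psiThree hξ h φ h₂ TP χlo χhi Stop Smin Psw U₃ V₃ C = fun z =>
    (fun r : ℝ × ℝ => 1 - C * (U₃ ((r.2 - a) - r.1 / 2) * V₃ ((r.2 - a) - r.1)))
      (H.topHeight hξ h φ h₂ TP χlo χhi Stop Smin Psw z, f z) := rfl

/-- **`ψ₁` has no critical point on the band part of the first sector** (nor on its faces off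
`F`): at a band point `z` with `f z ≤ a`, `D(z) ≤ 0`, `U₁, V₁' ≥ 0` and
`U₁' V₁ + U₁ V₁' > 0` (all evaluated at `u₁ = a - f z`, `v₁ = T/2 - s`), `C ≠ 0`.
[cite: GayKirby2016, §4, Lemma 14] -/
theorem not_isMCriticalPt_psiOne (hgl : IsGradientLike (𝓡 4) f ξ) (hfM : IsMorse (𝓡 4) f)
    (hT : ContMDiff (𝓡 4) 𝓘(ℝ, ℝ) ∞ (H.topHeight hξ h φ h₂ TP χlo χhi Stop Smin Psw))
    (hχlo : ContDiff ℝ ∞ χlo) (hχhi : ContDiff ℝ ∞ χhi)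
    {P₁ v₁ : ℝ} (hPsw0 : 0 < Psw) (hPsw : 2 * Psw ≤ η ^ 2) (hP₁ : 2 * P₁ < Psw)
    (hTP₂ : ∀ P, 2 * P₁ ≤ P → TP P = Stop) (hh₂v : ∀ t ≤ v₁, h₂ t = Stop)
    (hφv : ∀ j (y : RegularLevel h), y.1 ∈ (H.box j).chart.source → H.P j y.1 < 2 * Psw → φ y ≤ v₁)
    (hU : ContDiff ℝ ∞ U₁) (hV : ContDiff ℝ ∞ V₁) (hC : C ≠ 0)
    {z : X} (hf₁ : a - η < f z) (hf₂ : f z ≤ a)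
    (hD : H.topCoeff hξ h φ h₂ TP χlo χhi Stop Smin Psw z ≤ 0)
    (hUz : 0 ≤ U₁ (a - f z))
    (hV'z : 0 ≤ deriv V₁ (H.topHeight hξ h φ h₂ TP χlo χhi Stop Smin Psw z / 2 - (f z - a)))
    (hpos : 0 < deriv U₁ (a - f z) * V₁ (H.topHeight hξ h φ h₂ TP χlo χhi Stop Smin Psw z / 2 - (f z - a)) +
      U₁ (a - f z) * deriv V₁ (H.topHeight hξ h φ h₂ TP χlo χhi Stop Smin Psw z / 2 - (f z - a))) :
    ¬ IsMCriticalPt (𝓡 4) (H.psiOne hξ h φ h₂ TP χlo χhi Stop Smin Psw U₁ V₁ C) z := by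
  have hη := H.eta_pos
  rw [psiOne_eq]
  set T := H.topHeight hξ h φ h₂ TP χlo χhi Stop Smin Psw with hTdef
  obtain ⟨hΓd, h10, h01⟩ := gammaOne_partials hU hV a (T z, f z)
  -- the affine modification `1 - C Γ₁`
  have hΓ'd : DifferentiableAt ℝ (fun r : ℝ × ℝ => 1 - C * (U₁ (a - r.2) * V₁ (r.1 / 2 - (r.2 - a)))) (T z, f z) :=
    (differentiableAt_const _).sub ((differentiableAt_const _).mul hΓd)
  have hfd : fderiv ℝ (fun r : ℝ × ℝ => 1 - C * (U₁ (a - r.2) * V₁ (r.1 / 2 - (r.2 - a)))) (T z, f z) =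
      -C • fderiv ℝ (fun r : ℝ × ℝ => U₁ (a - r.2) * V₁ (r.1 / 2 - (r.2 - a))) (T z, f z) := by
    rw [fderiv_const_sub, fderiv_const_mul hΓd, ← neg_smul]
  refine H.not_isMCriticalPt_comp₂_of_ne hgl hfM hT hχlo hχhi hPsw0 hPsw hP₁ hTP₂ hh₂v hφv hΓ'd ?_
    (H.not_isMCriticalPt_of_band (by linarith) (by linarith) (by linarith)) hf₁ (by linarith)
  rw [hfd]
  simp only [FunLike.coe_smul, Pi.smul_apply, smul_eq_mul, h10, h01]
  have hterm : U₁ (a - f z) * deriv V₁ (T z / 2 - (f z - a)) / 2 * H.topCoeff hξ h φ h₂ TP χlo χhi Stop Smin Psw z ≤ 0 :=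
    mul_nonpos_of_nonneg_of_nonpos (by positivity) hD
  intro h0
  have : -C * (U₁ (a - f z) * deriv V₁ (T z / 2 - (f z - a)) / 2 * H.topCoeff hξ h φ h₂ TP χlo χhi Stop Smin Psw z +
      -(deriv U₁ (a - f z) * V₁ (T z / 2 - (f z - a)) + U₁ (a - f z) * deriv V₁ (T z / 2 - (f z - a)))) = 0 := by
    linarith [h0]
  rcases mul_eq_zero.1 this with h' | h'
  · exact hC (neg_eq_zero.1 h')
  · linarith

/-- **`ψ₃` has no critical point on the band part of the third sector** (nor on its faces off
`F`): at a band point `z` off the level `a + η`, with `D(z) ≤ 0`, `U₃, U₃', V₃, V₃' ≥ 0` and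
`U₃' V₃ + U₃ V₃' > 0` (at `u₃ = s - T/2`, `v₃ = s - T`), `C ≠ 0`. [cite: GayKirby2016, §4, Lemma 14] -/
theorem not_isMCriticalPt_psiThree (hgl : IsGradientLike (𝓡 4) f ξ) (hfM : IsMorse (𝓡 4) f)
    (hT : ContMDiff (𝓡 4) 𝓘(ℝ, ℝ) ∞ (H.topHeight hξ h φ h₂ TP χlo χhi Stop Smin Psw))
    (hχlo : ContDiff ℝ ∞ χlo) (hχhi : ContDiff ℝ ∞ χhi)
    {P₁ v₁ : ℝ} (hPsw0 : 0 < Psw) (hPsw : 2 * Psw ≤ η ^ 2) (hP₁ : 2 * P₁ < Psw)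
    (hTP₂ : ∀ P, 2 * P₁ ≤ P → TP P = Stop) (hh₂v : ∀ t ≤ v₁, h₂ t = Stop)
    (hφv : ∀ j (y : RegularLevel h), y.1 ∈ (H.box j).chart.source → H.P j y.1 < 2 * Psw → φ y ≤ v₁)
    (hU : ContDiff ℝ ∞ U₃) (hV : ContDiff ℝ ∞ V₃) (hC : C ≠ 0)
    {z : X} (hf₁ : a - η < f z) (hf₂ : f z < a + 2 * η) (hne : f z ≠ a + η)
    (hD : H.topCoeff hξ h φ h₂ TP χlo χhi Stop Smin Psw z ≤ 0)
    (hUz : 0 ≤ U₃ ((f z - a) - H.topHeight hξ h φ h₂ TP χlo χhi Stop Smin Psw z / 2))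
    (hU'z : 0 ≤ deriv U₃ ((f z - a) - H.topHeight hξ h φ h₂ TP χlo χhi Stop Smin Psw z / 2))
    (hVz : 0 ≤ V₃ ((f z - a) - H.topHeight hξ h φ h₂ TP χlo χhi Stop Smin Psw z))
    (hV'z : 0 ≤ deriv V₃ ((f z - a) - H.topHeight hξ h φ h₂ TP χlo χhi Stop Smin Psw z))
    (hpos : 0 < deriv U₃ ((f z - a) - H.topHeight hξ h φ h₂ TP χlo χhi Stop Smin Psw z / 2) *
        V₃ ((f z - a) - H.topHeight hξ h φ h₂ TP χlo χhi Stop Smin Psw z) +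
      U₃ ((f z - a) - H.topHeight hξ h φ h₂ TP χlo χhi Stop Smin Psw z / 2) *
        deriv V₃ ((f z - a) - H.topHeight hξ h φ h₂ TP χlo χhi Stop Smin Psw z)) :
    ¬ IsMCriticalPt (𝓡 4) (H.psiThree hξ h φ h₂ TP χlo χhi Stop Smin Psw U₃ V₃ C) z := by
  rw [psiThree_eq]
  set T := H.topHeight hξ h φ h₂ TP χlo χhi Stop Smin Psw with hTdef
  obtain ⟨hΓd, h10, h01⟩ := gammaThree_partials hU hV a (T z, f z)
  have hΓ'd : DifferentiableAt ℝ (fun r : ℝ × ℝ => 1 - C * (U₃ ((r.2 - a) - r.1 / 2) * V₃ ((r.2 - a) - r.1))) (T z, f z) :=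
    (differentiableAt_const _).sub ((differentiableAt_const _).mul hΓd)
  have hfd : fderiv ℝ (fun r : ℝ × ℝ => 1 - C * (U₃ ((r.2 - a) - r.1 / 2) * V₃ ((r.2 - a) - r.1))) (T z, f z) =
      -C • fderiv ℝ (fun r : ℝ × ℝ => U₃ ((r.2 - a) - r.1 / 2) * V₃ ((r.2 - a) - r.1)) (T z, f z) := by
    rw [fderiv_const_sub, fderiv_const_mul hΓd, ← neg_smul]
  refine H.not_isMCriticalPt_comp₂_of_ne hgl hfM hT hχlo hχhi hPsw0 hPsw hP₁ hTP₂ hh₂v hφv hΓ'd ?_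
    (H.not_isMCriticalPt_of_band hf₁.le hf₂ hne) hf₁ hf₂
  rw [hfd]
  simp only [FunLike.coe_smul, Pi.smul_apply, smul_eq_mul, h10, h01]
  have hterm : 0 ≤ -(deriv U₃ ((f z - a) - T z / 2) * V₃ ((f z - a) - T z) / 2 +
      U₃ ((f z - a) - T z / 2) * deriv V₃ ((f z - a) - T z)) * H.topCoeff hξ h φ h₂ TP χlo χhi Stop Smin Psw z := by
    have h1 : 0 ≤ deriv U₃ ((f z - a) - T z / 2) * V₃ ((f z - a) - T z) / 2 +
        U₃ ((f z - a) - T z / 2) * deriv V₃ ((f z - a) - T z) := by positivity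
    nlinarith
  intro h0
  have : -C * (-(deriv U₃ ((f z - a) - T z / 2) * V₃ ((f z - a) - T z) / 2 +
        U₃ ((f z - a) - T z / 2) * deriv V₃ ((f z - a) - T z)) * H.topCoeff hξ h φ h₂ TP χlo χhi Stop Smin Psw z +
      (deriv U₃ ((f z - a) - T z / 2) * V₃ ((f z - a) - T z) + U₃ ((f z - a) - T z / 2) * deriv V₃ ((f z - a) - T z))) = 0 := by
    linarith [h0]
  rcases mul_eq_zero.1 this with h' | h'
  · exact hC (neg_eq_zero.1 h')
  · linarith

/-- **Below the band, `ψ₁` is a function of `f` with the Morse data of `f`.**  At a point where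
`χ_lo = 0`, `χ_hi = 1` near `s = f - a` and `U₁ = 1` near `a - f`:
`ψ₁ = 1 - C V₁(S_top/2 - (f - a))` near the point, so `ψ₁` is critical iff `f` is, and then its
Hessian is nondegenerate and its index is that of `f` (`C V₁' > 0`). [cite: GayKirby2016, §4, Lemma 14]
[cite: Milnor1963, §2–§3] -/
theorem morseData_psiOne_below (hfM : IsMorse (𝓡 4) f) (hV : ContDiff ℝ ∞ V₁) (hC : 0 < C)
    {z : X} (hcut : ∀ᶠ s in 𝓝 (f z - a), χlo s = 0 ∧ χhi s = 1) (hU1 : ∀ᶠ u in 𝓝 (a - f z), U₁ u = 1)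
    (hV' : 0 < deriv V₁ (Stop / 2 - (f z - a))) :
    (IsMCriticalPt (𝓡 4) (H.psiOne hξ h φ h₂ TP χlo χhi Stop Smin Psw U₁ V₁ C) z ↔ IsMCriticalPt (𝓡 4) f z) ∧
      (IsMCriticalPt (𝓡 4) f z →
        (mhessian (𝓡 4) (H.psiOne hξ h φ h₂ TP χlo χhi Stop Smin Psw U₁ V₁ C) z).Nondegenerate ∧
          morseIndex (𝓡 4) (H.psiOne hξ h φ h₂ TP χlo χhi Stop Smin Psw U₁ V₁ C) z = morseIndex (𝓡 4) f z) := by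
  have hcontf : Continuous f := hfM.contMDiff.continuous
  -- `ψ₁ = φ₀ ∘ f` near `z`
  set φ₀ : ℝ → ℝ := fun q => 1 - C * V₁ (Stop / 2 - (q - a)) with hφ₀
  have hs : Tendsto (fun w => f w - a) (𝓝 z) (𝓝 (f z - a)) := (hcontf.continuousAt.sub continuousAt_const).tendsto
  have hs' : Tendsto (fun w => a - f w) (𝓝 z) (𝓝 (a - f z)) := (continuousAt_const.sub hcontf.continuousAt).tendsto
  have hev : H.psiOne hξ h φ h₂ TP χlo χhi Stop Smin Psw U₁ V₁ C =ᶠ[𝓝 z] fun w => φ₀ (f w) + 0 := by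
    filter_upwards [hs.eventually hcut, hs'.eventually hU1] with w hw hwU
    simp only [psiOne, H.topHeight_of_lo hw.1 hw.2, hwU, one_mul, hφ₀, add_zero]
  have hcrit := isMCriticalPt_congr_of_eventuallyEq_add_const (I := 𝓡 4) hev
  have hhess := mhessian_congr_of_eventuallyEq_add_const (I := 𝓡 4) hev
  -- Morse data of `φ₀ ∘ f`
  have hφ₀c : ContDiff ℝ ∞ φ₀ :=
    contDiff_const.sub (contDiff_const.mul (hV.comp (contDiff_const.sub (contDiff_id.sub contDiff_const))))
  have hφ₀' : deriv φ₀ (f z) = C * deriv V₁ (Stop / 2 - (f z - a)) := by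
    have h1 : HasDerivAt (fun q : ℝ => Stop / 2 - (q - a)) (-1) (f z) := by
      simpa using ((hasDerivAt_id (f z)).sub_const a).const_sub (Stop / 2)
    have h2 := ((hV.differentiable (by simp)) _).hasDerivAt.comp (f z) h1
    have h3 : HasDerivAt φ₀ (0 - C * (deriv V₁ (Stop / 2 - (f z - a)) * (-1))) (f z) :=
      (hasDerivAt_const _ _).sub (h2.const_mul C)
    rw [h3.deriv]; ring
  have hd : deriv φ₀ (f z) ≠ 0 := by rw [hφ₀']; positivity
  have hfd : MDifferentiableAt (𝓡 4) 𝓘(ℝ, ℝ) f z := hfM.contMDiff.mdifferentiableAt (by simp)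
  have hcrit₀ : IsMCriticalPt (𝓡 4) (fun y => φ₀ (f y)) z ↔ IsMCriticalPt (𝓡 4) f z :=
    isMCriticalPt_real_comp_iff' ((hφ₀c.differentiable (by simp)) _).hasDerivAt hd hfd
  refine ⟨hcrit.trans hcrit₀, fun hfz => ?_⟩
  obtain ⟨-, hnd, hidx, -⟩ := morseData_real_comp (hφ₀c.contDiffAt.of_le (by norm_cast))
    ((hfM.contMDiff z).of_le (by norm_cast)) hfz hd
  refine ⟨?_, ?_⟩
  · rw [hhess, hnd]; exact hfM.nondegenerate hfz
  · unfold morseIndex; rw [hhess]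
    exact hidx (by rw [hφ₀']; positivity)

/-- **Above the band, `ψ₃` is a function of `f` with the Morse data of `-f`.**  At a point where
`χ_lo = 1`, `χ_hi = 0` near `s = f - a` and `U₃ = 1` near `s + S_min/2`:
`ψ₃ = 1 - C V₃((f - a) + S_min)` near the point, so `ψ₃` is critical iff `f` is, and then its
Hessian is nondegenerate and `index ψ₃ + index f = 4`. [cite: GayKirby2016, §4, Lemma 14]
[cite: Milnor1963, §2–§3] -/
theorem morseData_psiThree_above (hfM : IsMorse (𝓡 4) f) (hV : ContDiff ℝ ∞ V₃) (hC : 0 < C)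
    {z : X} (hcut : ∀ᶠ s in 𝓝 (f z - a), χlo s = 1 ∧ χhi s = 0)
    (hU1 : ∀ᶠ u in 𝓝 ((f z - a) + Smin / 2), U₃ u = 1) (hV' : 0 < deriv V₃ ((f z - a) + Smin)) :
    (IsMCriticalPt (𝓡 4) (H.psiThree hξ h φ h₂ TP χlo χhi Stop Smin Psw U₃ V₃ C) z ↔ IsMCriticalPt (𝓡 4) f z) ∧
      (IsMCriticalPt (𝓡 4) f z →
        (mhessian (𝓡 4) (H.psiThree hξ h φ h₂ TP χlo χhi Stop Smin Psw U₃ V₃ C) z).Nondegenerate ∧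
          morseIndex (𝓡 4) (H.psiThree hξ h φ h₂ TP χlo χhi Stop Smin Psw U₃ V₃ C) z + morseIndex (𝓡 4) f z = 4) := by
  have hcontf : Continuous f := hfM.contMDiff.continuous
  set φ₀ : ℝ → ℝ := fun q => 1 - C * V₃ ((q - a) + Smin) with hφ₀
  have hs : Tendsto (fun w => f w - a) (𝓝 z) (𝓝 (f z - a)) := (hcontf.continuousAt.sub continuousAt_const).tendsto
  have hs' : Tendsto (fun w => (f w - a) + Smin / 2) (𝓝 z) (𝓝 ((f z - a) + Smin / 2)) := hs.add_const _
  have hev : H.psiThree hξ h φ h₂ TP χlo χhi Stop Smin Psw U₃ V₃ C =ᶠ[𝓝 z] fun w => φ₀ (f w) + 0 := by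
    filter_upwards [hs.eventually hcut, hs'.eventually hU1] with w hw hwU
    have hT : H.topHeight hξ h φ h₂ TP χlo χhi Stop Smin Psw w = -Smin := H.topHeight_of_hi hw.1 hw.2
    simp only [psiThree, hT, hφ₀, add_zero]
    rw [show (f w - a) - -Smin / 2 = (f w - a) + Smin / 2 by ring, hwU, one_mul,
      show (f w - a) - -Smin = (f w - a) + Smin by ring]
  have hcrit := isMCriticalPt_congr_of_eventuallyEq_add_const (I := 𝓡 4) hev
  have hhess := mhessian_congr_of_eventuallyEq_add_const (I := 𝓡 4) hev
  have hφ₀c : ContDiff ℝ ∞ φ₀ :=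
    contDiff_const.sub (contDiff_const.mul (hV.comp ((contDiff_id.sub contDiff_const).add contDiff_const)))
  have hφ₀' : deriv φ₀ (f z) = -(C * deriv V₃ ((f z - a) + Smin)) := by
    have h1 : HasDerivAt (fun q : ℝ => (q - a) + Smin) 1 (f z) := by
      simpa using ((hasDerivAt_id (f z)).sub_const a).add_const Smin
    have h2 := ((hV.differentiable (by simp)) _).hasDerivAt.comp (f z) h1
    have h3 : HasDerivAt φ₀ (0 - C * (deriv V₃ ((f z - a) + Smin) * 1)) (f z) :=
      (hasDerivAt_const _ _).sub (h2.const_mul C)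
    rw [h3.deriv]; ring
  have hd : deriv φ₀ (f z) ≠ 0 := by rw [hφ₀']; exact neg_ne_zero.2 (by positivity)
  have hfd : MDifferentiableAt (𝓡 4) 𝓘(ℝ, ℝ) f z := hfM.contMDiff.mdifferentiableAt (by simp)
  have hcrit₀ : IsMCriticalPt (𝓡 4) (fun y => φ₀ (f y)) z ↔ IsMCriticalPt (𝓡 4) f z :=
    isMCriticalPt_real_comp_iff' ((hφ₀c.differentiable (by simp)) _).hasDerivAt hd hfd
  refine ⟨hcrit.trans hcrit₀, fun hfz => ?_⟩
  obtain ⟨-, hnd, -, hidx⟩ := morseData_real_comp (hφ₀c.contDiffAt.of_le (by norm_cast))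
    ((hfM.contMDiff z).of_le (by norm_cast)) hfz hd
  refine ⟨?_, ?_⟩
  · rw [hhess, hnd]; exact hfM.nondegenerate hfz
  · unfold morseIndex; rw [hhess]
    have := hidx (by rw [hφ₀']; exact neg_neg_of_pos (by positivity)) (hfM.nondegenerate hfz)
    exact this

/-- The values: `ψ₁ ≤ 1` where `U₁ V₁ ≥ 0` and `C ≥ 0`, with equality iff `U₁ V₁ = 0` when `C > 0`. [folklore] -/
theorem psiOne_le_one (hC : 0 ≤ C) {z : X}
    (hUV : 0 ≤ U₁ (a - f z) * V₁ (H.topHeight hξ h φ h₂ TP χlo χhi Stop Smin Psw z / 2 - (f z - a))) :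
    H.psiOne hξ h φ h₂ TP χlo χhi Stop Smin Psw U₁ V₁ C z ≤ 1 := by
  unfold psiOne; nlinarith

/-- `ψ₁ = 1` iff `U₁ V₁ = 0` (`C ≠ 0`). [folklore] -/
theorem psiOne_eq_one_iff (hC : C ≠ 0) {z : X} :
    H.psiOne hξ h φ h₂ TP χlo χhi Stop Smin Psw U₁ V₁ C z = 1 ↔
      U₁ (a - f z) * V₁ (H.topHeight hξ h φ h₂ TP χlo χhi Stop Smin Psw z / 2 - (f z - a)) = 0 := by
  unfold psiOne
  constructor
  · intro h0
    have : C * (U₁ (a - f z) * V₁ (H.topHeight hξ h φ h₂ TP χlo χhi Stop Smin Psw z / 2 - (f z - a))) = 0 := by linarith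
    exact (mul_eq_zero.1 this).resolve_left hC
  · intro h0; rw [h0]; ring

/-- The values: `ψ₃ ≤ 1` where `U₃ V₃ ≥ 0` and `C ≥ 0`. [folklore] -/
theorem psiThree_le_one (hC : 0 ≤ C) {z : X}
    (hUV : 0 ≤ U₃ ((f z - a) - H.topHeight hξ h φ h₂ TP χlo χhi Stop Smin Psw z / 2) *
      V₃ ((f z - a) - H.topHeight hξ h φ h₂ TP χlo χhi Stop Smin Psw z)) :
    H.psiThree hξ h φ h₂ TP χlo χhi Stop Smin Psw U₃ V₃ C z ≤ 1 := by
  unfold psiThree; nlinarith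

/-- `ψ₃ = 1` iff `U₃ V₃ = 0` (`C ≠ 0`). [folklore] -/
theorem psiThree_eq_one_iff (hC : C ≠ 0) {z : X} :
    H.psiThree hξ h φ h₂ TP χlo χhi Stop Smin Psw U₃ V₃ C z = 1 ↔
      U₃ ((f z - a) - H.topHeight hξ h φ h₂ TP χlo χhi Stop Smin Psw z / 2) *
        V₃ ((f z - a) - H.topHeight hξ h φ h₂ TP χlo χhi Stop Smin Psw z) = 0 := by
  unfold psiThree
  constructor
  · intro h0
    have : C * (U₃ ((f z - a) - H.topHeight hξ h φ h₂ TP χlo χhi Stop Smin Psw z / 2) *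
        V₃ ((f z - a) - H.topHeight hξ h φ h₂ TP χlo χhi Stop Smin Psw z)) = 0 := by linarith
    exact (mul_eq_zero.1 this).resolve_left hC
  · intro h0; rw [h0]; ring

end HandleBoxes

end Band

end Literature.Topology.FourManifolds

end
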